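import Literature.Probability.Percolation.SlabCriticality
import Literature.Probability.Percolation.SlabGluingRouting
import HarnessLib

/-!
# Newman–Tassion–Wu 2017, Theorem 3.1: the box-crossing property of critical percolation on slabs
# (the crossing probability `f_p(m,n)`, the property, and the theorem as a named fact)

Topic: `Literature/Probability/Percolation`. Statement layer of §3 of Newman–Tassion–Wu,
*Critical percolation and the minimal spanning tree in slabs* (CPAM 70 (2017); arXiv:1512.09107),
in the vocabulary of the tree's ports of Duminil-Copin–Sidoravicius–Tassion 2016 and of NTW §3.2–3.3
(`SlabCriticality.lean`, `SlabRSWGluing*.lean`, `SlabRSWProp39*.lean`): the slab `S_k = ℤ² × {0,…,k}`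
is `slab 3 k = {x ∈ ℤ³ : 0 ≤ x₀ ≤ k}` with its induced graph `slabGraph 3 k`, the measure is
`P_p = bondPercolation (slabGraph 3 k) p`, planar sets are lifted (`slabLift k`), and
`slabConn k B X Y = {X̄ ⟷^{B̄} Ȳ}` is an open connection inside `B̄`.

* `NTW17.crossingProb k p m n` — NTW's `f(m,n) = f_p(m,n) := P_p[𝓗([0,m] × [0,n])]` (their (3.1)):
  the probability that the rectangle `[0,m] × [0,n]` of the slab `S_k` is crossed horizontally,
  i.e. that there is an open path inside `[0,m]×[0,n]×{0..k}` from the face `{x = 0}` to the face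
  `{x = m}`.  This is the quantity the NTW17 port writes inline as
  `(bondPercolation (slabGraph 3 k) p).real (slabConn k (boxR 0 m 0 n) {z | z.1 = 0} {z | z.1 = m})`
  (`crossingProb_eq`, `rfl`); by `Crossing.real_slabConn_lr_eq_real_boxCross`
  (`Summits/…/PercAnnulusCrossingSlabCrossingBridge.lean`) it equals the `ℤ³` block-crossing
  probability `P_p^{ℤ³}(Crossing.boxCross ![k,m,n] 1)` of the RSW3 lane.
* `NTW17.BoxCrossingProperty k p` — "the box-crossing property holds for `P_p` on `S_k`": NTW's
  display (3.2), `∀ ρ > 0 ∃ c_ρ > 0 ∀ n ≥ 1/ρ, c_ρ ≤ f(n, ⌊ρn⌋) ≤ 1 - c_ρ`, as a predicate of the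
  thickness `k` and the parameter `p`.
* `NewmanTassionWu2017_thm31` — NAMED FACT, NTW's Theorem 3.1: for every `k ≥ 1` the box-crossing
  property holds at `p = p_c(S_k)` (`criticalProbIOf (slabGraph 3 k) (slabOrigin 3 k)`).  Its proof
  (§3.2–3.7: gluing lemmas, Prop. 3.9, Lemmas 3.11–3.13, the RSW Theorems 3.14/3.17) is being ported
  (`SlabRSWGluing*`, `SlabRSWProp39*`, `SlabRSWLadder`, `Summits/…/PercAnnulusCrossingSlabBoxCrossing*`);
  the discharge `NewmanTassionWu2017_thm31_holds` is the end point of that programme.  Consequences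
  (Cor. 3.2 (ii)–(iii): blocked annuli, polynomial one-arm decay) are derived from
  `BoxCrossingProperty` in `SlabBoxCrossingPropertyBlocking.lean` / `…Annuli.lean` /
  `…Corollaries.lean`.
* API here: `crossingProb_eq` (`rfl`); `crossingProb_nonneg/_le_one`, `BoxCrossingProperty.lower/upper/nat`
  are in `SlabBoxCrossingPropertyCorollaries.lean`.

What is NOT here: Cor. 3.2 (i) (open circuits in annuli surrounding `B̄_n`; needs NTW's Thm. 3.10),
Thm. 2.4 (the minimal spanning forest of `S_k` is a tree), and any claim about `ℤ³` (`k = ∞`).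
The remark after Thm. 3.1 ("the bound `c_ρ` we obtain depends on the thickness `k` … converges
quickly to `0` as `k → ∞`") is reflected in the order of quantifiers (`c` depends on `k`, `p`, `ρ`).

## Sources

* C. M. Newman, V. Tassion, W. Wu, *Critical percolation and the minimal spanning tree in slabs*,
  Comm. Pure Appl. Math. 70 (2017) 2084–2120, arXiv:1512.09107: §3, (3.1), Theorem 3.1 with (3.2),
  and the Remark following it (pp. 7–8 of the arXiv text) [NewmanTassionWu2017].
-/

noncomputable section

namespace Literature.Probability.Percolation

open MeasureTheory LatticeModels

namespace NTW17

/-- **NTW's crossing probability `f_p(m,n)`** (Newman–Tassion–Wu 2017, (3.1)): "Let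
`R = [x,x'] × [y,y'] (× [k])` be a rectangle in `S_k`. We say that `R` is crossed horizontally if there
exists an open path from `{x} × [y,y']` to `{x'} × [y,y']` inside `R`. … For `m, n ≥ 1`, we define
`f(m,n) = f_p(m,n) := P_p[𝓗([0,m] × [0,n])]`."  Here: the `P_p^{S_k}`-probability of an open path of
the slab inside the lift of `[0,m] × [0,n]` from the lift of the line `{z.1 = 0}` to the lift of the
line `{z.1 = m}` (for `m, n : ℕ`; `f(0,n) = 1`). [cite: NewmanTassionWu2017, §3 (3.1)] -/
def crossingProb (k : ℕ) (p : unitInterval) (m n : ℕ) : ℝ :=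
  (bondPercolation (slabGraph 3 k) p).real (slabConn k (boxR 0 m 0 n) {z | z.1 = 0} {z | z.1 = (m : ℤ)})

/-- `f_p(m,n)` unfolded (for rewriting into the inline form used by the `NTW17` port).
[cite: NewmanTassionWu2017, §3 (3.1)] -/
theorem crossingProb_eq (k : ℕ) (p : unitInterval) (m n : ℕ) :
    crossingProb k p m n =
      (bondPercolation (slabGraph 3 k) p).real (slabConn k (boxR 0 m 0 n) {z | z.1 = 0} {z | z.1 = (m : ℤ)}) :=
  rfl

/-- **The box-crossing property for `P_p` on the slab `S_k`** (the conclusion (3.2) of NTW's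
Theorem 3.1, as a predicate): "For every `ρ > 0`, there exists a constant `c_ρ` (`> 0`) such that for
every `n ≥ 1/ρ`, `c_ρ ≤ f(n, ⌊ρn⌋) ≤ 1 - c_ρ`."  The constant may depend on `k`, `p` and `ρ`.
[cite: NewmanTassionWu2017, Theorem 3.1 ((3.2))] -/
def BoxCrossingProperty (k : ℕ) (p : unitInterval) : Prop :=
  ∀ ρ : ℝ, 0 < ρ → ∃ c : ℝ, 0 < c ∧ ∀ n : ℕ, 1 ≤ ρ * n →
    c ≤ crossingProb k p n ⌊ρ * n⌋₊ ∧ crossingProb k p n ⌊ρ * n⌋₊ ≤ 1 - c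

end NTW17

/-- NAMED FACT — **Newman–Tassion–Wu 2017, Theorem 3.1 (box-crossing property for critical
percolation on slabs)**: "Let `p = p_c(S_k)`. For every `ρ > 0`, there exists a constant `c_ρ` such
that for every `n ≥ 1/ρ`, `c_ρ ≤ f(n, ⌊ρn⌋) ≤ 1 - c_ρ`" — for every slab `S_k = ℤ² × {0,…,k}`,
`k ≥ 1` ("for every fixed `k ≥ 1`", §3, p. 7).  Here `p_c(S_k) = criticalProbIOf (slabGraph 3 k) (slabOrigin 3 k)`
and `f = NTW17.crossingProb k p`.  Users take `(h : NewmanTassionWu2017_thm31)`; the discharge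
`NewmanTassionWu2017_thm31_holds` is the goal of the NTW17 port (Layers 1–4 of the RSW3 lane's
programme). [cite: NewmanTassionWu2017, Theorem 3.1] -/
def NewmanTassionWu2017_thm31 : Prop :=
  ∀ k : ℕ, 1 ≤ k →
    NTW17.BoxCrossingProperty k (criticalProbIOf (slabGraph 3 k) (slabOrigin 3 k))

end Literature.Probability.Percolation
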